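import Literature.MathematicalPhysics.QuantumFieldTheory.King1986.MinimizerDecayUniform
import Literature.MathematicalPhysics.QuantumFieldTheory.King1986.CovarianceSplitting
import HarnessLib

/-!
# [Ba 4] Theorem (1.10) ∕ King 1986 Theorem 3.3 for the KERNEL of the `A = 0` fluctuation propagator `G^ε_K = (−Δ^ε + m² +
# a_KQ_K^*Q_K)⁻¹` — ENTRYWISE, with the constants UNIFORM IN THE MASS `0 ≤ m² ≤ m₀²`, in King's torus spelling
# (`King1986.Torus.fineOp`, `constrainedProp`): the point-source reading of `B4Thm110ZeroTorusUniform.thm110_zero_torus_unif`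
# through the bridge `MinimizerTowerBridge.fineOp_inv_toTor_toTor`

**Citation header (reproduction of PUBLISHED and PROVED work; seat `pub-ymgap-dag-n15-e` (generation 6) of the cell `pub-ymgap`,
Track-A node N15 = NE2, King-model rung; sequel of `King1986/MinimizerDecayUniform` (the same transport for the minimiser kernel
`ℋ_K = a_KG^ε_KQ_K^*`) and of `Balaban1983to89/B4Thm110ZeroTorusUniform`).**  C. King, *The U(1) Higgs model. I. The continuum
limit*, Commun. Math. Phys. **102** (1986) 649–677 [King1986], (2.13) p. 653 (the constrained Gaussian `exp(−½[η^dΣψ(−Δ + m²)ψ +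
a_k|Q_kψ|²])`, covariance `G^η_k`), Theorem 3.3 (3.7) p. 658 («see [Ba 4]»), §4 p. 670, (4.44) p. 675 (`G = N^dA₀⁻¹`); [Ba 4] = T. Bałaban,
*Regularity and decay of lattice Green's functions*, Commun. Math. Phys. **89** (1983) 571–597 [Balaban1983RegularityDecay],
Theorem (1.10) p. 573: «|(G_k(Ω, A)f)(x)| ≤ c₀ exp(−δ₀ dist(x, supp f))‖f‖_∞ … constants … independent of A, k, Ω and depending
on d, M only».

**The point.**  The cell's King-model rung (node N15) sums King's slice decomposition (2.17) of `G^η_K` one level at a time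
(`Summits/…/BalabanUVNodesN15KingModelFullPropagator`); the bottom of that induction is the ONE-level propagator `G^ε_1`, whose
kernel bound is (1.10) with a point source.  This file types that reading for EVERY number of levels `K ≥ 1` (it is what the
print gives), in three currencies:
* §1 `fineOp_inv_decay_unif` — tower labels: `|A₀⁻¹(toTor x, toTor y)| ≤ c₀·e^{−δ₀·ε|x − y|_{T_ε}}` for every volume with `K ≥ 1`
  and every `0 ≤ m² ≤ m₀²` (`thm110_zero_torus_unif` with `f = δ_y`, `‖f‖_∞ = 1`, `dist(x, supp f) = |x − y|`, read through
  `fineOp_inv_toTor_toTor`: `A₀ = c(−Δ) + m² + aQ^*Q` with `c = ε⁻²`, `a = a_K` IS the re-indexed `−Δ^ε + m² + a_KP_K`);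
* §2 `fineOp_inv_decay_blocks_unif` — King's spelling (`aK`, `c = N²`, `N = L^K`) and BLOCK-DISTANCE currency:
  `|(fineOp N M a_K N² m²)⁻¹(x, y)| ≤ c₀·e^{−δ₀·|B(x) − B(y)|_M}` (`MinimizerBlockDecay.T_blk_le_eps_mul`: `|B(x) − B(y)| ≤ ε|x − y| + 2`);
* §3 `constrainedProp_decay_blocks_unif` — the same for King's `G^ε_K = N^d·A₀⁻¹` (`CovarianceSplitting.constrainedProp`):
  `|G^ε_K(x, y)| ≤ N^d·c₀·e^{−δ₀·|B(x) − B(y)|_M}`.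

**HONEST SCOPE.**  (i) `A = 0`, periodic b.c., Bałaban's volumes `M_μ = 2L^m`, odd `L > 1`; (ii) the factor `N^d = (L^K)^d` in §3 is
the price of reading the SUP-NORM estimate (1.10) with a POINT source (`‖δ_y‖_∞ = 1` while the kernel of `G^ε_K` w.r.t. the counting
measure is `N^d` times the `ε^d`-weighted one): §3 is sharp in `K` only at `K = 1`, which is exactly how the Summits-side induction uses
it — the `K`-uniform off-diagonal bound of `G^ε_K` is NOT this file's claim; (iii) no derivative ∕ Hölder clause (same transport, on ask).
HONEST FRAMING: King's `A = 0` scalar MODEL on finite tori; template literature; nothing about Bałaban's covariant `G_k(U)`; nothing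
continuum ∕ ℝ⁴ ∕ OS ∕ mass-gap ∕ Clay; count-neutral for the cell's 27 nodes.
-/

noncomputable section

open Finset Real Matrix
open scoped BigOperators

namespace Literature.MathematicalPhysics.QuantumFieldTheory.King1986

open Literature.MathematicalPhysics.QuantumFieldTheory.Balaban1983to89 (Params)
open Literature.MathematicalPhysics.QuantumFieldTheory.Balaban1983to89.B5Prop11Plancherel
open Literature.MathematicalPhysics.QuantumFieldTheory.Balaban1983to89.B1RG242Torus (tower)
open Literature.MathematicalPhysics.QuantumFieldTheory.Balaban1983to89.B5Ineq137Torus (T blk)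

namespace Torus

variable {d : ℕ}

/-! ## §1 (1.10) with a point source, through the bridge, mass-uniform -/

/-- **[Ba 4] (1.10) ∕ King's Theorem 3.3 FOR THE KERNEL OF `G^ε_K = A₀⁻¹` (tower labels), mass-uniform**: for `d ≥ 1`, odd `L > 1`,
`a > 0` and a cap `m₀² ≥ 0` there are `δ₀, c₀ > 0` (functions of `d, L, a, m₀²`) such that for EVERY `0 ≤ m² ≤ m₀²`, every volume
`P = (d, L, m, K)` with `K ≥ 1`, every unit torus `M_μ = 2L^m` of it and all fine points `x, y`:
`|A₀⁻¹(toTor x, toTor y)| ≤ c₀·e^{−δ₀·ε|x − y|_{T_ε}}` (`A₀ = fineOp (L^K) M a_K ε⁻² m²`; `|·|_{T_ε}` the sup torus distance in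
fine lattice units, so `ε|x − y|` is the physical distance).  Proof: `thm110_zero_torus_unif` with the point source `f = δ_y`
(`‖f‖_∞ = 1`, `dist(x, supp f) = |x − y|`) and `fineOp_inv_toTor_toTor`. [cite: Balaban1983RegularityDecay, Theorem (1.10) p.573; King1986, Theorem 3.3 (3.7) p.658, (4.44) p.675] -/
theorem fineOp_inv_decay_unif (dd L : ℕ) (hd : 1 ≤ dd) (hL : Odd L ∧ 1 < L) {a : ℝ} (ha : 0 < a) {m0sq : ℝ}
    (hm0 : 0 ≤ m0sq) :
    ∃ δ₀ c₀ : ℝ, 0 < δ₀ ∧ 0 < c₀ ∧ ∀ (P : Params), P.d = dd → P.L = L → 1 ≤ P.K →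
      ∀ (msq : ℝ), 0 ≤ msq → msq ≤ m0sq →
      ∀ (M : Fin P.d → ℕ) [∀ μ, NeZero (M μ)] (hMK : ∀ μ, M μ = P.sitesPerDir P.K)
        (x y : Balaban1983to89.Site P 0),
        |(fineOp (P.L ^ P.K) M (Balaban1983to89.B1.aSeq a P.L P.K) ((P.eps⁻¹) ^ 2) msq)⁻¹
            (toTor P M hMK x) (toTor P M hMK y)|
          ≤ c₀ * Real.exp (-(δ₀ * (P.eps * T P 0 x y))) := by
  obtain ⟨δ₀, c₀, hδ₀, hc₀, H⟩ :=
    Balaban1983to89.B4Thm110ZeroTorus.thm110_zero_torus_unif dd L hd hL ha hm0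
  refine ⟨δ₀, c₀, hδ₀, hc₀, ?_⟩
  intro P hPd hPL hK msq hmsq hcap M _ hMK x y
  -- the point source `f = δ_y`: `‖f‖_∞ ≤ 1`, support `{y}`
  have hF : ∀ z, |(Pi.single y (1 : ℝ) : Balaban1983to89.Site P 0 → ℝ) z| ≤ 1 := by
    intro z
    by_cases hz : z = y
    · subst hz; rw [Pi.single_eq_same, abs_one]
    · rw [Pi.single_eq_of_ne hz, abs_zero]; exact zero_le_one
  have hsupp : ∀ z, (Pi.single y (1 : ℝ) : Balaban1983to89.Site P 0 → ℝ) z ≠ 0 → T P 0 x y ≤ T P 0 x z := by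
    intro z hz
    by_cases h : z = y
    · subst h; exact le_rfl
    · exact absurd (Pi.single_eq_of_ne h _) hz
  have hmain := (H P hPd hPL msq hmsq hcap P.K hK le_rfl x (Pi.single y 1) 1 (T P 0 x y) hF
    (Balaban1983to89.B5Ineq137Torus.T_nonneg P 0 x y) hsupp).1
  rw [Matrix.mulVec_single_one, Matrix.col_apply, mul_one] at hmain
  rw [fineOp_inv_toTor_toTor P M hMK]
  exact hmain

/-! ## §2 King's spelling and the block-distance currency -/

/-- **The same in KING'S SPELLING and BLOCK-DISTANCE CURRENCY** (`a_K = aK a L K`, `c = N²`, any spelling `N = L^K` of the number of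
fine points per block, King-side points given directly): `∃ δ₀ c₀ > 0` (functions of `d, L, a, m₀²`) with
`|(fineOp N M a_K N² m²)⁻¹(x, y)| ≤ c₀·e^{−δ₀·|B(x) − B(y)|_M}` for EVERY `0 ≤ m² ≤ m₀²`, every volume, all fine `x, y` — (1.10) for
the kernel in the unit-torus distance of the blocks (`|B(x) − B(y)|_M ≤ ε|x − y| + 2`, `T_blk_le_eps_mul`; the slack `e^{2δ₀}` is in
`c₀`). [cite: Balaban1983RegularityDecay, Theorem (1.10) p.573; King1986, Theorem 3.3 (3.7) p.658, Prop. 3.7 (3.64) p.663] -/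
theorem fineOp_inv_decay_blocks_unif (dd L : ℕ) (hd : 1 ≤ dd) (hL : Odd L ∧ 1 < L) {a : ℝ} (ha : 0 < a) {m0sq : ℝ}
    (hm0 : 0 ≤ m0sq) :
    ∃ δ₀ c₀ : ℝ, 0 < δ₀ ∧ 0 < c₀ ∧ ∀ (P : Params), P.d = dd → P.L = L → 1 ≤ P.K →
      ∀ (msq : ℝ), 0 ≤ msq → msq ≤ m0sq →
      ∀ (M : Fin P.d → ℕ) [∀ μ, NeZero (M μ)] (_hMK : ∀ μ, M μ = P.sitesPerDir P.K)
        (N : ℕ) [NeZero N] (_hN : N = P.L ^ P.K) (xt yt : Tor (fine N M)),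
        |(fineOp N M (aK a P.L P.K) (((N : ℕ) : ℝ) ^ 2) msq)⁻¹ xt yt|
          ≤ c₀ * Real.exp (-(δ₀ * tdistT M (blockOf N M xt) (blockOf N M yt))) := by
  obtain ⟨δ₀, c₀, hδ₀, hc₀, H⟩ := fineOp_inv_decay_unif dd L hd hL ha hm0
  refine ⟨δ₀, c₀ * Real.exp (2 * δ₀), hδ₀, by positivity, ?_⟩
  intro P hPd hPL hK msq hmsq hcap M _ hMK N _ hN xt yt
  subst hN
  set x : Balaban1983to89.Site P 0 := (torEquiv P M hMK).symm xt with hxdef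
  set y : Balaban1983to89.Site P 0 := (torEquiv P M hMK).symm yt with hydef
  have hxt : toTor P M hMK x = xt := (torEquiv P M hMK).apply_symm_apply xt
  have hyt : toTor P M hMK y = yt := (torEquiv P M hMK).apply_symm_apply yt
  have hε : 0 < P.eps := Params.eps_pos P
  -- the label-side bound, in King's spelling of the constants
  have hmain := H P hPd hPL hK msq hmsq hcap M hMK x y
  rw [aSeq_eq_aK, eps_inv_sq, hxt, hyt] at hmain
  -- block distance ≤ physical distance + 2
  have hblk : tdistT M (blockOf (P.L ^ P.K) M xt) (blockOf (P.L ^ P.K) M yt) ≤ P.eps * T P 0 x y + 2 := by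
    rw [← hxt, ← hyt, blockOf_toTor P M hMK y, tdistT_blockOf_toTor, ← blk_eq_proj]
    exact T_blk_le_eps_mul P x y
  have hexp : Real.exp (-(δ₀ * (P.eps * T P 0 x y)))
      ≤ Real.exp (2 * δ₀) * Real.exp (-(δ₀ * tdistT M (blockOf (P.L ^ P.K) M xt) (blockOf (P.L ^ P.K) M yt))) := by
    rw [← Real.exp_add]
    apply Real.exp_le_exp.mpr
    nlinarith [mul_le_mul_of_nonneg_left hblk hδ₀.le]
  calc |(fineOp (P.L ^ P.K) M (aK a P.L P.K) ((((P.L ^ P.K : ℕ) : ℝ)) ^ 2) msq)⁻¹ xt yt|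
      ≤ c₀ * Real.exp (-(δ₀ * (P.eps * T P 0 x y))) := hmain
    _ ≤ c₀ * (Real.exp (2 * δ₀)
          * Real.exp (-(δ₀ * tdistT M (blockOf (P.L ^ P.K) M xt) (blockOf (P.L ^ P.K) M yt)))) :=
        mul_le_mul_of_nonneg_left hexp hc₀.le
    _ = c₀ * Real.exp (2 * δ₀)
          * Real.exp (-(δ₀ * tdistT M (blockOf (P.L ^ P.K) M xt) (blockOf (P.L ^ P.K) M yt))) := by ring

/-! ## §3 King's `G^ε_K = N^d·A₀⁻¹` -/

/-- **(1.10) FOR KING'S BLOCK-CONSTRAINED PROPAGATOR `G^ε_K = N^d·A₀⁻¹`** (`CovarianceSplitting.constrainedProp`, the covariance of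
the constrained Gaussian (2.13) in level-`K` lattice units): `|G^ε_K(x, y)| ≤ N^d·c₀·e^{−δ₀·|B(x) − B(y)|_M}` for EVERY `0 ≤ m² ≤ m₀²`
and every volume, with the `(δ₀, c₀)` of §2.  The factor `N^d = (L^K)^d` is the point-source price of the sup-norm form of (1.10)
(HONEST SCOPE (ii)); the Summits-side induction of node N15 consumes this at `K = 1` only.
[cite: Balaban1983RegularityDecay, Theorem (1.10) p.573; King1986, (2.13) p.653, Theorem 3.3 (3.7) p.658, (4.44) p.675] -/
theorem constrainedProp_decay_blocks_unif (dd L : ℕ) (hd : 1 ≤ dd) (hL : Odd L ∧ 1 < L) {a : ℝ} (ha : 0 < a) {m0sq : ℝ}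
    (hm0 : 0 ≤ m0sq) :
    ∃ δ₀ c₀ : ℝ, 0 < δ₀ ∧ 0 < c₀ ∧ ∀ (P : Params), P.d = dd → P.L = L → 1 ≤ P.K →
      ∀ (msq : ℝ), 0 ≤ msq → msq ≤ m0sq →
      ∀ (M : Fin P.d → ℕ) [∀ μ, NeZero (M μ)] (_hMK : ∀ μ, M μ = P.sitesPerDir P.K)
        (N : ℕ) [NeZero N] (_hN : N = P.L ^ P.K) (xt yt : Tor (fine N M)),
        |constrainedProp N M (aK a P.L P.K) (((N : ℕ) : ℝ) ^ 2) msq xt yt|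
          ≤ ((N : ℝ) ^ P.d) * c₀ * Real.exp (-(δ₀ * tdistT M (blockOf N M xt) (blockOf N M yt))) := by
  obtain ⟨δ₀, c₀, hδ₀, hc₀, H⟩ := fineOp_inv_decay_blocks_unif dd L hd hL ha hm0
  refine ⟨δ₀, c₀, hδ₀, hc₀, ?_⟩
  intro P hPd hPL hK msq hmsq hcap M _ hMK N _ hN xt yt
  have h := H P hPd hPL hK msq hmsq hcap M hMK N hN xt yt
  have hNd : 0 ≤ (N : ℝ) ^ P.d := by positivity
  rw [constrainedProp, Matrix.smul_apply, smul_eq_mul, abs_mul, abs_of_nonneg hNd, mul_assoc]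
  exact mul_le_mul_of_nonneg_left h hNd

/-! ## §4 (v1.1) The derivative clause: (1.10) clause 2 with a point source, through the bridge, mass-uniform

[Ba 4] (1.10) prints the same majorant for `|(D^η_{A,μ}G_k(Ω, A)f)(x)|`; King's Theorem 3.3 (3.7) quotes it with the derivative.
The bridge is `toTor_shift` (a lattice step of `T_ε` is a lattice step of `Tor (fine L^K M)`) + B1's `deriv_mulVec`
(`(∂^ε_μ g)(x) = ε⁻¹(g(x + e_μ) − g(x))`); the transport to King's spelling and the block currency is §2's, verbatim. -/

open Literature.MathematicalPhysics.QuantumFieldTheory.Balaban1983to89.B1RG242Torus (deriv deriv_mulVec)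

/-- **The bridge for the derivative of the kernel**: `ε⁻¹·(A₀⁻¹(toTor x + e_μ, toTor y) − A₀⁻¹(toTor x, toTor y)) =
((∂^ε_μG_K(T_ε, 0)) δ_y)(x)` (`fineOp_inv_toTor_toTor` at `x + e_μ` and `x`, `toTor_shift`, `deriv_mulVec`).
[cite: Balaban1982Higgs1, (1.4) p.604; Balaban1983RegularityDecay, (1.6) p.572; King1986, Theorem 3.3 (3.7) p.658] -/
theorem fineOp_inv_deriv_toTor (P : Params) (M : Fin P.d → ℕ) [∀ μ, NeZero (M μ)]
    (hMK : ∀ μ, M μ = P.sitesPerDir P.K) (a msq : ℝ) (x y : Balaban1983to89.Site P 0) (μ : Fin P.d) :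
    P.eps⁻¹ * ((fineOp (P.L ^ P.K) M (Balaban1983to89.B1.aSeq a P.L P.K) ((P.eps⁻¹) ^ 2) msq)⁻¹
          (toTor P M hMK x + unitVec (fine (P.L ^ P.K) M) μ) (toTor P M hMK y)
        - (fineOp (P.L ^ P.K) M (Balaban1983to89.B1.aSeq a P.L P.K) ((P.eps⁻¹) ^ 2) msq)⁻¹
          (toTor P M hMK x) (toTor P M hMK y))
      = ((deriv P 0 P.eps μ * (tower P a msq).G P.K) *ᵥ (Pi.single y 1)) x := by
  rw [← toTor_shift P M hMK x μ, fineOp_inv_toTor_toTor P M hMK, fineOp_inv_toTor_toTor P M hMK,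
    ← Matrix.mulVec_mulVec, deriv_mulVec, Matrix.mulVec_single_one]
  rfl

/-- **[Ba 4] (1.10), CLAUSE 2, FOR THE KERNEL OF `G^ε_K = A₀⁻¹` (tower labels), mass-uniform**: `∃ δ₀ c₀ > 0` (functions of
`d, L, a, m₀²`) such that for EVERY `0 ≤ m² ≤ m₀²`, every volume with `K ≥ 1`, all fine points `x, y` and directions `μ`:
`|ε⁻¹·(A₀⁻¹(toTor x + e_μ, toTor y) − A₀⁻¹(toTor x, toTor y))| ≤ c₀·e^{−δ₀·ε|x − y|_{T_ε}}` — `thm110_zero_torus_unif` clause 2 with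
the point source `f = δ_y`, read through `fineOp_inv_deriv_toTor`. [cite: Balaban1983RegularityDecay, Theorem (1.10) p.573; King1986, Theorem 3.3 (3.7) p.658] -/
theorem fineOp_inv_deriv_decay_unif (dd L : ℕ) (hd : 1 ≤ dd) (hL : Odd L ∧ 1 < L) {a : ℝ} (ha : 0 < a) {m0sq : ℝ}
    (hm0 : 0 ≤ m0sq) :
    ∃ δ₀ c₀ : ℝ, 0 < δ₀ ∧ 0 < c₀ ∧ ∀ (P : Params), P.d = dd → P.L = L → 1 ≤ P.K →
      ∀ (msq : ℝ), 0 ≤ msq → msq ≤ m0sq →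
      ∀ (M : Fin P.d → ℕ) [∀ μ, NeZero (M μ)] (hMK : ∀ μ, M μ = P.sitesPerDir P.K)
        (x y : Balaban1983to89.Site P 0) (μ : Fin P.d),
        |P.eps⁻¹ * ((fineOp (P.L ^ P.K) M (Balaban1983to89.B1.aSeq a P.L P.K) ((P.eps⁻¹) ^ 2) msq)⁻¹
              (toTor P M hMK x + unitVec (fine (P.L ^ P.K) M) μ) (toTor P M hMK y)
            - (fineOp (P.L ^ P.K) M (Balaban1983to89.B1.aSeq a P.L P.K) ((P.eps⁻¹) ^ 2) msq)⁻¹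
              (toTor P M hMK x) (toTor P M hMK y))|
          ≤ c₀ * Real.exp (-(δ₀ * (P.eps * T P 0 x y))) := by
  obtain ⟨δ₀, c₀, hδ₀, hc₀, H⟩ :=
    Balaban1983to89.B4Thm110ZeroTorus.thm110_zero_torus_unif dd L hd hL ha hm0
  refine ⟨δ₀, c₀, hδ₀, hc₀, ?_⟩
  intro P hPd hPL hK msq hmsq hcap M _ hMK x y μ
  have hF : ∀ z, |(Pi.single y (1 : ℝ) : Balaban1983to89.Site P 0 → ℝ) z| ≤ 1 := by
    intro z
    by_cases hz : z = y
    · subst hz; rw [Pi.single_eq_same, abs_one]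
    · rw [Pi.single_eq_of_ne hz, abs_zero]; exact zero_le_one
  have hsupp : ∀ z, (Pi.single y (1 : ℝ) : Balaban1983to89.Site P 0 → ℝ) z ≠ 0 → T P 0 x y ≤ T P 0 x z := by
    intro z hz
    by_cases h : z = y
    · subst h; exact le_rfl
    · exact absurd (Pi.single_eq_of_ne h _) hz
  have hmain := (H P hPd hPL msq hmsq hcap P.K hK le_rfl x (Pi.single y 1) 1 (T P 0 x y) hF
    (Balaban1983to89.B5Ineq137Torus.T_nonneg P 0 x y) hsupp).2 μ
  rw [mul_one] at hmain
  rw [fineOp_inv_deriv_toTor P M hMK]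
  exact hmain

/-- **The same in KING'S SPELLING and BLOCK-DISTANCE CURRENCY**: `∃ δ₀ c₀ > 0` with
`|N·((fineOp N M a_K N² m²)⁻¹(x + e_μ, y) − (fineOp N M a_K N² m²)⁻¹(x, y))| ≤ c₀·e^{−δ₀·|B(x) − B(y)|_M}` for EVERY `0 ≤ m² ≤ m₀²`,
every volume, all fine `x, y`, `μ` (`N = L^K = ε⁻¹`; the slack `e^{2δ₀}` of `T_blk_le_eps_mul` is in `c₀`).
[cite: Balaban1983RegularityDecay, Theorem (1.10) p.573; King1986, Theorem 3.3 (3.7) p.658, Prop. 3.7 (3.63) p.663] -/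
theorem fineOp_inv_deriv_decay_blocks_unif (dd L : ℕ) (hd : 1 ≤ dd) (hL : Odd L ∧ 1 < L) {a : ℝ} (ha : 0 < a)
    {m0sq : ℝ} (hm0 : 0 ≤ m0sq) :
    ∃ δ₀ c₀ : ℝ, 0 < δ₀ ∧ 0 < c₀ ∧ ∀ (P : Params), P.d = dd → P.L = L → 1 ≤ P.K →
      ∀ (msq : ℝ), 0 ≤ msq → msq ≤ m0sq →
      ∀ (M : Fin P.d → ℕ) [∀ μ, NeZero (M μ)] (_hMK : ∀ μ, M μ = P.sitesPerDir P.K)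
        (N : ℕ) [NeZero N] (_hN : N = P.L ^ P.K) (xt yt : Tor (fine N M)) (μ : Fin P.d),
        |(N : ℝ) * ((fineOp N M (aK a P.L P.K) (((N : ℕ) : ℝ) ^ 2) msq)⁻¹ (xt + unitVec (fine N M) μ) yt
            - (fineOp N M (aK a P.L P.K) (((N : ℕ) : ℝ) ^ 2) msq)⁻¹ xt yt)|
          ≤ c₀ * Real.exp (-(δ₀ * tdistT M (blockOf N M xt) (blockOf N M yt))) := by
  obtain ⟨δ₀, c₀, hδ₀, hc₀, H⟩ := fineOp_inv_deriv_decay_unif dd L hd hL ha hm0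
  refine ⟨δ₀, c₀ * Real.exp (2 * δ₀), hδ₀, by positivity, ?_⟩
  intro P hPd hPL hK msq hmsq hcap M _ hMK N _ hN xt yt μ
  subst hN
  set x : Balaban1983to89.Site P 0 := (torEquiv P M hMK).symm xt with hxdef
  set y : Balaban1983to89.Site P 0 := (torEquiv P M hMK).symm yt with hydef
  have hxt : toTor P M hMK x = xt := (torEquiv P M hMK).apply_symm_apply xt
  have hyt : toTor P M hMK y = yt := (torEquiv P M hMK).apply_symm_apply yt
  have hε : 0 < P.eps := Params.eps_pos P
  have hepsN : P.eps⁻¹ = ((P.L ^ P.K : ℕ) : ℝ) := by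
    rw [Params.eps, inv_pow, inv_inv]; push_cast; rfl
  -- the label-side bound, in King's spelling of the constants
  have hmain := H P hPd hPL hK msq hmsq hcap M hMK x y μ
  rw [aSeq_eq_aK, eps_inv_sq, hepsN, hxt, hyt] at hmain
  -- block distance ≤ physical distance + 2
  have hblk : tdistT M (blockOf (P.L ^ P.K) M xt) (blockOf (P.L ^ P.K) M yt) ≤ P.eps * T P 0 x y + 2 := by
    rw [← hxt, ← hyt, blockOf_toTor P M hMK y, tdistT_blockOf_toTor, ← blk_eq_proj]
    exact T_blk_le_eps_mul P x y
  have hexp : Real.exp (-(δ₀ * (P.eps * T P 0 x y)))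
      ≤ Real.exp (2 * δ₀) * Real.exp (-(δ₀ * tdistT M (blockOf (P.L ^ P.K) M xt) (blockOf (P.L ^ P.K) M yt))) := by
    rw [← Real.exp_add]
    apply Real.exp_le_exp.mpr
    nlinarith [mul_le_mul_of_nonneg_left hblk hδ₀.le]
  calc |(((P.L ^ P.K : ℕ) : ℝ)) * ((fineOp (P.L ^ P.K) M (aK a P.L P.K) ((((P.L ^ P.K : ℕ) : ℝ)) ^ 2) msq)⁻¹
              (xt + unitVec (fine (P.L ^ P.K) M) μ) yt
            - (fineOp (P.L ^ P.K) M (aK a P.L P.K) ((((P.L ^ P.K : ℕ) : ℝ)) ^ 2) msq)⁻¹ xt yt)|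
      ≤ c₀ * Real.exp (-(δ₀ * (P.eps * T P 0 x y))) := hmain
    _ ≤ c₀ * (Real.exp (2 * δ₀)
          * Real.exp (-(δ₀ * tdistT M (blockOf (P.L ^ P.K) M xt) (blockOf (P.L ^ P.K) M yt)))) :=
        mul_le_mul_of_nonneg_left hexp hc₀.le
    _ = c₀ * Real.exp (2 * δ₀)
          * Real.exp (-(δ₀ * tdistT M (blockOf (P.L ^ P.K) M xt) (blockOf (P.L ^ P.K) M yt))) := by ring

/-- **(1.10) CLAUSE 2 FOR KING'S `G^ε_K = N^d·A₀⁻¹`, in lattice units of level `K`**: `|N·(G^ε_K(x + e_μ, y) − G^ε_K(x, y))| ≤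
N^d·c₀·e^{−δ₀·|B(x) − B(y)|_M}` — the forward η-derivative `∂^η_μG^ε_K = η⁻¹(G^ε_K(· + ηe_μ) − G^ε_K)` of the kernel in the
observation point, with the point-source factor `N^d` of §3 (honest; consumed at `K = 1` by the Summits-side gradient induction).
[cite: Balaban1983RegularityDecay, Theorem (1.10) p.573; King1986, (2.13) p.653, Theorem 3.3 (3.7) p.658, (4.44) p.675] -/
theorem constrainedProp_deriv_decay_blocks_unif (dd L : ℕ) (hd : 1 ≤ dd) (hL : Odd L ∧ 1 < L) {a : ℝ} (ha : 0 < a)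
    {m0sq : ℝ} (hm0 : 0 ≤ m0sq) :
    ∃ δ₀ c₀ : ℝ, 0 < δ₀ ∧ 0 < c₀ ∧ ∀ (P : Params), P.d = dd → P.L = L → 1 ≤ P.K →
      ∀ (msq : ℝ), 0 ≤ msq → msq ≤ m0sq →
      ∀ (M : Fin P.d → ℕ) [∀ μ, NeZero (M μ)] (_hMK : ∀ μ, M μ = P.sitesPerDir P.K)
        (N : ℕ) [NeZero N] (_hN : N = P.L ^ P.K) (xt yt : Tor (fine N M)) (μ : Fin P.d),
        |(N : ℝ) * (constrainedProp N M (aK a P.L P.K) (((N : ℕ) : ℝ) ^ 2) msq (xt + unitVec (fine N M) μ) yt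
            - constrainedProp N M (aK a P.L P.K) (((N : ℕ) : ℝ) ^ 2) msq xt yt)|
          ≤ ((N : ℝ) ^ P.d) * c₀ * Real.exp (-(δ₀ * tdistT M (blockOf N M xt) (blockOf N M yt))) := by
  obtain ⟨δ₀, c₀, hδ₀, hc₀, H⟩ := fineOp_inv_deriv_decay_blocks_unif dd L hd hL ha hm0
  refine ⟨δ₀, c₀, hδ₀, hc₀, ?_⟩
  intro P hPd hPL hK msq hmsq hcap M _ hMK N _ hN xt yt μ
  have h := H P hPd hPL hK msq hmsq hcap M hMK N hN xt yt μ
  have hNd : 0 ≤ (N : ℝ) ^ P.d := by positivity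
  rw [constrainedProp, Matrix.smul_apply, Matrix.smul_apply, smul_eq_mul, smul_eq_mul, ← mul_sub, mul_left_comm, abs_mul,
    abs_of_nonneg hNd, mul_assoc]
  exact mul_le_mul_of_nonneg_left h hNd

/-! ## §5 (v1.2) The sup-norm form of (1.10) itself in King's spelling: `|(A₀⁻¹f)(x)| ≤ c₀‖f‖_∞`, every volume, every mass under the cap

The OPERATOR form is what [Ba 4] prints; no point-source price.  The Summits-side operator-form η-rate of the full propagator (node N15, PART P)
uses it for both runs at the bottom of its induction. -/

/-- **[Ba 4] (1.10) ∕ King's Theorem 3.3 (3.7) IN KING'S SPELLING, OPERATOR FORM, mass-uniform**: `∃ c₀ > 0` (function of `d, L, a, m₀²`) such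
that for EVERY `0 ≤ m² ≤ m₀²`, every volume `(d, L, m, K)` with `K ≥ 1`, any spelling `N = L^K`, every `f` on the fine torus with `|f| ≤ F` and
every fine point `x`:  `|((fineOp N M a_K N² m²)⁻¹ f)(x)| ≤ c₀·F` — the sup-norm bound of `G_K(T_ε, 0) = A₀⁻¹`, uniform in the number of
levels (`thm110_zero_torus_unif` at `D = 0`, read through `fineOp_inv_toTor_toTor` entry by entry and `torEquiv`).
[cite: Balaban1983RegularityDecay, Theorem (1.10) p.573; King1986, Theorem 3.3 (3.7) p.658] -/
theorem fineOp_inv_mulVec_le_unif (dd L : ℕ) (hd : 1 ≤ dd) (hL : Odd L ∧ 1 < L) {a : ℝ} (ha : 0 < a) {m0sq : ℝ}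
    (hm0 : 0 ≤ m0sq) :
    ∃ c₀ : ℝ, 0 < c₀ ∧ ∀ (P : Params), P.d = dd → P.L = L → 1 ≤ P.K →
      ∀ (msq : ℝ), 0 ≤ msq → msq ≤ m0sq →
      ∀ (M : Fin P.d → ℕ) [∀ μ, NeZero (M μ)] (_hMK : ∀ μ, M μ = P.sitesPerDir P.K)
        (N : ℕ) [NeZero N] (_hN : N = P.L ^ P.K) (f : Tor (fine N M) → ℝ) (F : ℝ), (∀ y, |f y| ≤ F) →
        ∀ xt : Tor (fine N M),
        |((fineOp N M (aK a P.L P.K) (((N : ℕ) : ℝ) ^ 2) msq)⁻¹ *ᵥ f) xt| ≤ c₀ * F := by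
  obtain ⟨δ₀, c₀, hδ₀, hc₀, H⟩ :=
    Balaban1983to89.B4Thm110ZeroTorus.thm110_zero_torus_unif dd L hd hL ha hm0
  refine ⟨c₀, hc₀, ?_⟩
  intro P hPd hPL hK msq hmsq hcap M _ hMK N _ hN f F hF xt
  subst hN
  set x : Balaban1983to89.Site P 0 := (torEquiv P M hMK).symm xt with hxdef
  have hxt : toTor P M hMK x = xt := (torEquiv P M hMK).apply_symm_apply xt
  -- the source on the tower's fine lattice
  set g : Balaban1983to89.Site P 0 → ℝ := fun z => f (toTor P M hMK z) with hgdef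
  have hgF : ∀ z, |g z| ≤ F := fun z => hF _
  have hmain := (H P hPd hPL msq hmsq hcap P.K hK le_rfl x g F 0 hgF le_rfl
    (fun z _ => Balaban1983to89.B5Ineq137Torus.T_nonneg P 0 x z)).1
  rw [mul_zero, mul_zero, neg_zero, Real.exp_zero, mul_one] at hmain
  -- `(A₀⁻¹ f)(toTor x) = (G_K g)(x)` entry by entry
  have hsum : ((fineOp (P.L ^ P.K) M (aK a P.L P.K) ((((P.L ^ P.K : ℕ) : ℝ)) ^ 2) msq)⁻¹ *ᵥ f) xt
      = ((tower P a msq).G P.K *ᵥ g) x := by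
    rw [← hxt, Matrix.mulVec, Matrix.mulVec, dotProduct, dotProduct,
      ← (torEquiv P M hMK).sum_comp (fun yt => (fineOp (P.L ^ P.K) M (aK a P.L P.K)
        ((((P.L ^ P.K : ℕ) : ℝ)) ^ 2) msq)⁻¹ (toTor P M hMK x) yt * f yt)]
    refine Finset.sum_congr rfl fun y _ => ?_
    show (fineOp (P.L ^ P.K) M (aK a P.L P.K) ((((P.L ^ P.K : ℕ) : ℝ)) ^ 2) msq)⁻¹ (toTor P M hMK x) (toTor P M hMK y)
        * f (toTor P M hMK y) = (tower P a msq).G P.K x y * g y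
    rw [← aSeq_eq_aK, ← eps_inv_sq, fineOp_inv_toTor_toTor P M hMK]
  rw [hsum]
  exact hmain

/-- **The same WITH THE PRINTED DECAY FROM THE SUPPORT, in block-distance currency**: `∃ δ₀ c₀ > 0` such that for EVERY `0 ≤ m² ≤ m₀²`, every
volume, any spelling `N = L^K`, every `f` with `|f| ≤ F` vanishing on the fine points whose unit block is within torus distance `< D` of the block
of `x`:  `|((fineOp N M a_K N² m²)⁻¹ f)(x)| ≤ c₀·e^{−δ₀D}·F` — [Ba 4] (1.10) `c₀exp(−δ₀ dist(x, supp f))‖f‖_∞` with `dist` read on the unit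
blocks (`T_blk_le_eps_mul`: the block distance is at most the physical distance `+ 2`, the slack `e^{2δ₀}` is in `c₀`).
[cite: Balaban1983RegularityDecay, Theorem (1.10) p.573; King1986, Theorem 3.3 (3.7) p.658] -/
theorem fineOp_inv_mulVec_decay_unif (dd L : ℕ) (hd : 1 ≤ dd) (hL : Odd L ∧ 1 < L) {a : ℝ} (ha : 0 < a) {m0sq : ℝ}
    (hm0 : 0 ≤ m0sq) :
    ∃ δ₀ c₀ : ℝ, 0 < δ₀ ∧ 0 < c₀ ∧ ∀ (P : Params), P.d = dd → P.L = L → 1 ≤ P.K →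
      ∀ (msq : ℝ), 0 ≤ msq → msq ≤ m0sq →
      ∀ (M : Fin P.d → ℕ) [∀ μ, NeZero (M μ)] (_hMK : ∀ μ, M μ = P.sitesPerDir P.K)
        (N : ℕ) [NeZero N] (_hN : N = P.L ^ P.K) (f : Tor (fine N M) → ℝ) (F D : ℝ), (∀ y, |f y| ≤ F) →
        ∀ xt : Tor (fine N M), (∀ yt, f yt ≠ 0 → D ≤ tdistT M (blockOf N M xt) (blockOf N M yt)) →
        |((fineOp N M (aK a P.L P.K) (((N : ℕ) : ℝ) ^ 2) msq)⁻¹ *ᵥ f) xt| ≤ c₀ * Real.exp (-(δ₀ * D)) * F := by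
  obtain ⟨δ₀, c₀, hδ₀, hc₀, H⟩ :=
    Balaban1983to89.B4Thm110ZeroTorus.thm110_zero_torus_unif dd L hd hL ha hm0
  refine ⟨δ₀, c₀ * Real.exp (2 * δ₀), hδ₀, by positivity, ?_⟩
  intro P hPd hPL hK msq hmsq hcap M _ hMK N _ hN f F D hF xt hsupp
  subst hN
  set x : Balaban1983to89.Site P 0 := (torEquiv P M hMK).symm xt with hxdef
  have hxt : toTor P M hMK x = xt := (torEquiv P M hMK).apply_symm_apply xt
  have hε : 0 < P.eps := Params.eps_pos P
  -- the source on the tower's fine lattice and the fine distance fed to (1.10)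
  set g : Balaban1983to89.Site P 0 → ℝ := fun z => f (toTor P M hMK z) with hgdef
  have hgF : ∀ z, |g z| ≤ F := fun z => hF _
  set D' : ℝ := max 0 ((D - 2) / P.eps) with hD'def
  have hD'0 : 0 ≤ D' := le_max_left _ _
  have hD'le : ∀ z : Balaban1983to89.Site P 0, g z ≠ 0 → D' ≤ T P 0 x z := by
    intro z hz
    rcases le_total ((D - 2) / P.eps) 0 with h | h
    · rw [hD'def, max_eq_left h]
      exact Balaban1983to89.B5Ineq137Torus.T_nonneg P 0 x z
    · rw [hD'def, max_eq_right h, div_le_iff₀ hε]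
      have hdom := T_blk_le_eps_mul P x z
      have hDz := hsupp (toTor P M hMK z) hz
      rw [← hxt, blockOf_toTor P M hMK z, tdistT_blockOf_toTor, ← blk_eq_proj] at hDz
      linarith [mul_comm P.eps (T P 0 x z)]
  have hεD : D - 2 ≤ P.eps * D' := by
    have h1 : P.eps * ((D - 2) / P.eps) ≤ P.eps * D' := mul_le_mul_of_nonneg_left (le_max_right _ _) hε.le
    rwa [mul_div_cancel₀ _ hε.ne'] at h1
  have hmain := (H P hPd hPL msq hmsq hcap P.K hK le_rfl x g F D' hgF hD'0 hD'le).1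
  have hF0 : 0 ≤ F := (abs_nonneg _).trans (hF xt)
  have hexp : Real.exp (-(δ₀ * (P.eps * D'))) ≤ Real.exp (2 * δ₀) * Real.exp (-(δ₀ * D)) := by
    rw [← Real.exp_add]
    apply Real.exp_le_exp.mpr
    nlinarith [mul_le_mul_of_nonneg_left hεD hδ₀.le]
  -- `(A₀⁻¹ f)(toTor x) = (G_K g)(x)` entry by entry
  have hsum : ((fineOp (P.L ^ P.K) M (aK a P.L P.K) ((((P.L ^ P.K : ℕ) : ℝ)) ^ 2) msq)⁻¹ *ᵥ f) xt
      = ((tower P a msq).G P.K *ᵥ g) x := by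
    rw [← hxt, Matrix.mulVec, Matrix.mulVec, dotProduct, dotProduct,
      ← (torEquiv P M hMK).sum_comp (fun yt => (fineOp (P.L ^ P.K) M (aK a P.L P.K)
        ((((P.L ^ P.K : ℕ) : ℝ)) ^ 2) msq)⁻¹ (toTor P M hMK x) yt * f yt)]
    refine Finset.sum_congr rfl fun y _ => ?_
    show (fineOp (P.L ^ P.K) M (aK a P.L P.K) ((((P.L ^ P.K : ℕ) : ℝ)) ^ 2) msq)⁻¹ (toTor P M hMK x) (toTor P M hMK y)
        * f (toTor P M hMK y) = (tower P a msq).G P.K x y * g y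
    rw [← aSeq_eq_aK, ← eps_inv_sq, fineOp_inv_toTor_toTor P M hMK]
  rw [hsum]
  calc |((tower P a msq).G P.K *ᵥ g) x| ≤ c₀ * Real.exp (-(δ₀ * (P.eps * D'))) * F := hmain
    _ ≤ c₀ * (Real.exp (2 * δ₀) * Real.exp (-(δ₀ * D))) * F :=
        mul_le_mul_of_nonneg_right (mul_le_mul_of_nonneg_left hexp hc₀.le) hF0
    _ = c₀ * Real.exp (2 * δ₀) * Real.exp (-(δ₀ * D)) * F := by ring

end Torus

end Literature.MathematicalPhysics.QuantumFieldTheory.King1986
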